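import Literature.Analysis.FluidPDE.NSGalerkinFourier
import HarnessLib

/-!
# The zero mode of the Fourier–Galerkin system: mean conservation

Analysis/FluidPDE proof file (theorems only). For the Fourier–Galerkin system `ċ = V(g, c)` of the
Navier–Stokes equations on `T^d` (`Torus.galerkinField` / `galerkinRHS`, `NSGalerkinFourier`;
Robinson–Rodrigo–Sadowski 2016, §4.1 (4.5); Constantin–Foias 1988, (8.5)) the zero Fourier mode is
driven by the force alone: the Stokes term vanishes at `k = 0`, the Leray multiplier is the identity
there, and the convection symbol has no zero mode on the phase space (`∫(u·∇)u = 0` for real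
divergence-free fields — at the coefficient level the `l + m = 0` terms carry `c(−m)·m = conj(m·c(m)) = 0`).
Hence along a Galerkin solution with mean-free force the mean `û(0)` is conserved, and a trajectory
issued from a mean-zero datum keeps mean-zero slices — the standing hypothesis of the critical
(`Ḣ^{1/2}`) estimates (`TorusGalerkinCriticalSobolev*`), where the Sobolev embeddings need zero mean.

* `convectionCoeff_self_zero_freq`, `galerkinField_zero_freq` (`V(g,c)_0 = g 0`, every dimension);
* `hasZeroMean_realTrigPoly_of` (`∫ realTrigPoly S c = 0` iff the zero coefficient vanishes);
* `galerkin_coeff_zero_freq_eq` (mean conservation along `β' = V(g, β)` on `[0, T]` when `g 0 = 0`).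

NOT here: forces with nonzero mean (momentum balance), field-level trajectories.

## Mathlib / tree search

Reused `convectionCoeff_def`, `galerkinField_def`, `leraySym_zero_freq`, `freqNormSq_zero`,
`mFourierCoeff_realTrigPoly`, `EuclideanSpace.complexify.integral_comp_comm`, Mathlib
`Convex.norm_image_sub_le_of_norm_hasDerivWithin_le`. The field-level momentum identity for weak
solutions is the tree's `Torus.IsWeakNSSolutionForcedOn.integral_inner_const_eq_ae`
(`WeakSolutionMomentumTorus`); nothing existed at the Galerkin coefficient level (searched
`convectionCoeff.*0`, `zero_freq`, `HasZeroMean.*realTrigPoly`).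

## References

* J. C. Robinson, J. L. Rodrigo, W. Sadowski, *The Three-Dimensional Navier–Stokes Equations*,
  CUP 2016, §4.1 (4.5), Thm 4.4 Step 1. [RobinsonRodrigoSadowskiCUP2016]
-/

noncomputable section

open MeasureTheory Set Filter UnitAddTorus
open scoped ENNReal NNReal InnerProductSpace

namespace Literature.Analysis.FluidPDE

/-! ### The zero mode of the Galerkin field; mean conservation -/

section Mean

open FunctionSpaces.Torus Torus

variable {d : Type*} [Fintype d] {S : Finset (d → ℤ)}

/-- **The zero mode of the convection symbol vanishes on the Galerkin phase space**:
`𝓕((u·∇)u)(0) = 0` for real divergence-free coefficient families (`∫ (u·∇)u = 0`), at the level of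
`Torus.convectionCoeff`: the `l + m = 0` terms carry the factor `c(−m)·m = conj(m·c(m)) = 0`. [folklore] -/
private theorem convectionCoeff_self_zero_freq {c : (d → ℤ) → EuclideanSpace ℂ d} (hc : IsConjSymm c)
    (hcT : IsTransversal S c) : convectionCoeff S c c 0 = 0 := by
  rw [convectionCoeff_def]
  refine Finset.sum_eq_zero fun l hl => Finset.sum_eq_zero fun m hm => ?_
  split_ifs with hlm
  · have hl' : l = -m := eq_neg_of_add_eq_zero_left hlm
    have hsum : ∑ j, c l j * (m j : ℂ) = 0 := by
      rw [hl', hc m]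
      have ht := hcT m hm
      have h1 : ∑ j, FunctionSpaces.EuclideanSpace.conjVec (c m) j * (m j : ℂ) =
          starRingEnd ℂ (∑ j, (m j : ℂ) * c m j) := by
        rw [map_sum]
        refine Finset.sum_congr rfl fun j _ => ?_
        rw [map_mul, map_intCast, FunctionSpaces.EuclideanSpace.conjVec_apply, mul_comm]
      rw [h1, ht, map_zero]
    rw [hsum, mul_zero, zero_smul]
  · rfl

/-- **The zero mode of the Galerkin field is the zero mode of the force** (the Stokes term vanishes
at `k = 0`, the Leray multiplier is the identity there, and the convection symbol has no zero mode
on the phase space): `V(g, c)_0 = g 0`. [folklore] -/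
private theorem galerkinField_zero_freq (ν : ℝ) {g c : (d → ℤ) → EuclideanSpace ℂ d} (hc : IsConjSymm c)
    (hcT : IsTransversal S c) : galerkinField ν S g c 0 = g 0 := by
  rw [galerkinField_def, convectionCoeff_self_zero_freq hc hcT, sub_zero, leraySym_zero_freq,
    freqNormSq_zero, mul_zero, mul_zero, Complex.ofReal_zero, zero_smul, neg_zero, zero_add]

/-- A real trigonometric polynomial has zero mean if its zero coefficient vanishes (when `0 ∈ S`;
off `S` there is nothing to check): `complexify (∫ u) = 𝓕u(0) = c 0` (Grafakos 2014, §3.1: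
`f̂(0) = ∫ f`; Prop. 3.2.7 for the coefficients of trigonometric polynomials).
[cite: Grafakos2014, Prop. 3.2.7 (3)] -/
theorem hasZeroMean_realTrigPoly_of (hS : ∀ k ∈ S, -k ∈ S) {c : (d → ℤ) → EuclideanSpace ℂ d}
    (hc : IsConjSymm c) (h0 : (0 : d → ℤ) ∈ S → c 0 = 0) : HasZeroMean (realTrigPoly S c) := by
  have h1 : mFourierCoeff (FunctionSpaces.EuclideanSpace.complexify ∘ realTrigPoly S c) 0 = 0 := by
    rw [mFourierCoeff_realTrigPoly hS hc]
    by_cases h : (0 : d → ℤ) ∈ S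
    · rw [if_pos h, h0 h]
    · rw [if_neg h]
  rw [mFourierCoeff_eq_integral_volume] at h1
  simp only [neg_zero, mFourier_zero, ContinuousMap.one_apply, one_smul, Function.comp_apply] at h1
  rw [FunctionSpaces.EuclideanSpace.complexify.integral_comp_comm (realTrigPoly S c)] at h1
  exact FunctionSpaces.EuclideanSpace.complexify_injective (h1.trans (map_zero _).symm)

/-- **Mean conservation for Galerkin solutions with mean-free force**: along a solution of the
Galerkin ODE `ċ = V(g, c)` (Robinson–Rodrigo–Sadowski 2016, (4.5); Constantin–Foias 1988, (8.5)) on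
`[0, T]` in the phase space, with force coefficients `g` vanishing at the zero mode, the zero
coefficient is constant: at `k = 0` the system (4.5) reads `ċ₀ = V(g, c)₀ = g₀ = 0` (the Stokes term
vanishes, the Leray multiplier is the identity, and the convection symbol has no zero mode on the
phase space). RRS work in the mean-free space `H` where this is built in; here the mean mode is kept
and shown to be force-driven. [cite: RobinsonRodrigoSadowskiCUP2016, §4.1 (4.5), Thm 4.4 Step 1] -/
theorem galerkin_coeff_zero_freq_eq (hS : ∀ k ∈ S, -k ∈ S) {β : ℝ → ↥S → EuclideanSpace ℂ d}
    {g : ↥S → EuclideanSpace ℂ d} {ν T : ℝ} (h0S : (0 : d → ℤ) ∈ S)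
    (hβ : ∀ t ∈ Icc 0 T, HasDerivWithinAt β (galerkinRHS S ν g (β t)) (Icc 0 T) t)
    (hmem : ∀ t ∈ Icc 0 T, β t ∈ galerkinSubspace S) (hg : g ⟨0, h0S⟩ = 0) :
    ∀ t ∈ Icc 0 T, β t ⟨0, h0S⟩ = β 0 ⟨0, h0S⟩ := by
  have hd : ∀ t ∈ Icc 0 T, HasDerivWithinAt (fun τ => β τ ⟨0, h0S⟩) 0 (Icc 0 T) t := by
    intro t ht
    have h : HasDerivWithinAt (fun τ => β τ ⟨0, h0S⟩) (galerkinRHS S ν g (β t) ⟨0, h0S⟩)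
        (Icc 0 T) t :=
      (ContinuousLinearMap.proj (R := ℝ) (φ := fun _ : ↥S => EuclideanSpace ℂ d)
        ⟨0, h0S⟩).hasFDerivAt.comp_hasDerivWithinAt t (hβ t ht)
    have hval : galerkinRHS S ν g (β t) ⟨0, h0S⟩ = 0 := by
      rw [galerkinRHS_apply]
      change galerkinField ν S (coeffExt S g) (coeffExt S (β t)) 0 = 0
      rw [galerkinField_zero_freq ν ((hmem t ht).1.isConjSymm_coeffExt hS)
        (hmem t ht).2.isTransversal_coeffExt, coeffExt_of_mem g h0S, hg]
    rw [hval] at h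
    exact h
  intro t ht
  have hc : ∀ x ∈ Icc 0 T, ‖(0 : EuclideanSpace ℂ d)‖ ≤ 0 := fun _ _ => by simp
  have h := (convex_Icc 0 T).norm_image_sub_le_of_norm_hasDerivWithin_le hd hc
    (left_mem_Icc.2 (ht.1.trans ht.2)) ht
  rw [zero_mul, norm_le_zero_iff, sub_eq_zero] at h
  exact h

end Mean


end Literature.Analysis.FluidPDE
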